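import Mathlib
import Summits.MatrixMultiplication.MatrixMultiplication.Theorems.SnSubsetDichotomyNoThresholdSubsetTriplePlancherelStepDefs

/-!
# Adding a corner shifts the J-increment of every other corner by `±π` (stub `incr_insert_of_ne`)

Stub `incr_insert_of_ne` ((F2a) of the lead-c7 report, app. A) of line `klr-graded-polynomial-method`
(crux `SnSubsetDichotomy.NoThresholdSubsetTriple`, stmt-MatrixMultiplication-8302).

Let `ν ⊆ ℕ × ℕ` be a finite lower set (a Young diagram, cells `(row, col)`), and let `y ≠ z` be two
addable nodes (outer corners) of `ν`, `z = (r, c)`, `π = (−1)^{r+c}`.  Then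
`incr (insert z ν) y = incr ν y ± π`, with the sign `+` iff `y` lies strictly above `z`.

Proof.
* Since `z` is addable and `ν` is a lower set, row `r` of `ν` is `{(r, j) : j < c}` and column `c`
  is `{(i, c) : i < r}`; so inserting `z` changes `rowLen r : c ↦ c + 1` and `colLen c : r ↦ r + 1`
  and nothing else, whence `rowCharge` changes only at `r`, by `(−1)^r · (−1)^c = π`, and
  `colCharge` only at `c`, by `π` (`PlancherelStep.rowCharge_insert`).
* The tails `chargeBelow r' = Σ_{i > r'} rowCharge i` therefore change by `[r' < r] · π`, and
  `chargeRight c'` by `[c' < c] · π`; the summation range `range (|ν| + 1)` grows by the single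
  index `|ν| + 1`, whose row and column are empty (every cell of a lower set has coordinates `< |ν|`,
  and `r, c ≤ |ν|`).
* Two distinct addable nodes of a lower set are strictly NE/SW of each other:
  `(y.1 < r ∧ c < y.2) ∨ (r < y.1 ∧ y.2 < c)`; so exactly one of the two brackets is `1`, giving
  `incr (insert z ν) y − incr ν y = [y.1 < r] π − [y.2 < c] π = ± π`.
-/

open scoped BigOperators
open Literature.RepresentationTheory.FiniteGroups (addableNodes IsAddableNode)

namespace Summit.MatrixMultiplication.MatrixMultiplication.Theorems

open PlancherelStep

/-! ### Cells of a finite lower set have small coordinates -/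

set_option linter.dupNamespace false in
/-- Down-closure of a lower set of cells, coordinatewise. [folklore] -/
private theorem mem_of_le {ν : Finset (ℕ × ℕ)} (hν : IsLowerSet (ν : Set (ℕ × ℕ))) {i₀ j₀ : ℕ}
    (ha : (i₀, j₀) ∈ ν) {i j : ℕ} (hi : i ≤ i₀) (hj : j ≤ j₀) : (i, j) ∈ ν :=
  Finset.mem_coe.1 (hν (Prod.mk_le_mk.2 ⟨hi, hj⟩) (Finset.mem_coe.2 ha))

set_option linter.dupNamespace false in
/-- In a finite lower set `ν ⊆ ℕ × ℕ` every cell has row index `< |ν|`: the column segment above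
it already consists of `row + 1` cells of `ν`. [folklore] -/
private theorem fst_lt_card {ν : Finset (ℕ × ℕ)} (hν : IsLowerSet (ν : Set (ℕ × ℕ))) {x : ℕ × ℕ}
    (hx : x ∈ ν) : x.1 < ν.card := by
  obtain ⟨i, j⟩ := x
  have hsub : (Finset.range (i + 1)).image (fun k => (k, j)) ⊆ ν := by
    intro y hy
    obtain ⟨k, hk, rfl⟩ := Finset.mem_image.1 hy
    exact mem_of_le hν hx (Nat.le_of_lt_succ (Finset.mem_range.1 hk)) le_rfl
  have hcard : ((Finset.range (i + 1)).image (fun k => (k, j))).card = i + 1 := by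
    rw [Finset.card_image_of_injective _ fun a b h => (Prod.ext_iff.1 h).1, Finset.card_range]
  have h := Finset.card_le_card hsub
  rw [hcard] at h
  exact h

set_option linter.dupNamespace false in
/-- In a finite lower set `ν ⊆ ℕ × ℕ` every cell has column index `< |ν|`. [folklore] -/
private theorem snd_lt_card {ν : Finset (ℕ × ℕ)} (hν : IsLowerSet (ν : Set (ℕ × ℕ))) {x : ℕ × ℕ}
    (hx : x ∈ ν) : x.2 < ν.card := by
  obtain ⟨i, j⟩ := x
  have hsub : (Finset.range (j + 1)).image (fun k => (i, k)) ⊆ ν := by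
    intro y hy
    obtain ⟨k, hk, rfl⟩ := Finset.mem_image.1 hy
    exact mem_of_le hν hx le_rfl (Nat.le_of_lt_succ (Finset.mem_range.1 hk))
  have hcard : ((Finset.range (j + 1)).image (fun k => (i, k))).card = j + 1 := by
    rw [Finset.card_image_of_injective _ fun a b h => (Prod.ext_iff.1 h).2, Finset.card_range]
  have h := Finset.card_le_card hsub
  rw [hcard] at h
  exact h

set_option linter.dupNamespace false in
/-- Rows of index `≥ |ν|` of a finite lower set `ν` are empty. [folklore] -/
private theorem rowLen_eq_zero {ν : Finset (ℕ × ℕ)} (hν : IsLowerSet (ν : Set (ℕ × ℕ))) {i : ℕ}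
    (hi : ν.card ≤ i) : rowLen ν i = 0 := by
  rw [rowLen, Finset.card_eq_zero, Finset.filter_eq_empty_iff]
  intro x hx hxi
  have := fst_lt_card hν hx
  omega

set_option linter.dupNamespace false in
/-- Columns of index `≥ |ν|` of a finite lower set `ν` are empty. [folklore] -/
private theorem colLen_eq_zero {ν : Finset (ℕ × ℕ)} (hν : IsLowerSet (ν : Set (ℕ × ℕ))) {j : ℕ}
    (hj : ν.card ≤ j) : colLen ν j = 0 := by
  rw [colLen, Finset.card_eq_zero, Finset.filter_eq_empty_iff]
  intro x hx hxj
  have := snd_lt_card hν hx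
  omega

/-! ### The row and the column of an addable node -/

set_option linter.dupNamespace false in
/-- The row of an addable node `z` of a lower set `ν` is the initial segment of length `z.2`:
`(z.1, j) ∈ ν ↔ j < z.2`. [folklore] -/
private theorem mk_fst_mem_iff {ν : Finset (ℕ × ℕ)} (hν : IsLowerSet (ν : Set (ℕ × ℕ)))
    {z : ℕ × ℕ} (hz : IsAddableNode ν z) (j : ℕ) : (z.1, j) ∈ ν ↔ j < z.2 := by
  obtain ⟨hzν, -, hleft⟩ := hz
  constructor
  · intro h
    by_contra hj
    have hz' : (z.1, z.2) ∈ ν := mem_of_le hν h le_rfl (Nat.not_lt.1 hj)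
    exact hzν hz'
  · intro hj
    rcases hleft with h0 | hmem
    · omega
    · exact mem_of_le hν hmem le_rfl (Nat.le_sub_one_of_lt hj)

set_option linter.dupNamespace false in
/-- The column of an addable node `z` of a lower set `ν` is the initial segment of length `z.1`:
`(i, z.2) ∈ ν ↔ i < z.1`. [folklore] -/
private theorem mk_snd_mem_iff {ν : Finset (ℕ × ℕ)} (hν : IsLowerSet (ν : Set (ℕ × ℕ)))
    {z : ℕ × ℕ} (hz : IsAddableNode ν z) (i : ℕ) : (i, z.2) ∈ ν ↔ i < z.1 := by
  obtain ⟨hzν, hup, -⟩ := hz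
  constructor
  · intro h
    by_contra hi
    have hz' : (z.1, z.2) ∈ ν := mem_of_le hν h (Nat.not_lt.1 hi) le_rfl
    exact hzν hz'
  · intro hi
    rcases hup with h0 | hmem
    · omega
    · exact mem_of_le hν hmem (Nat.le_sub_one_of_lt hi) le_rfl

set_option linter.dupNamespace false in
/-- For an addable node `z` of a lower set `ν`: `rowLen ν z.1 = z.2`. [folklore] -/
private theorem rowLen_fst {ν : Finset (ℕ × ℕ)} (hν : IsLowerSet (ν : Set (ℕ × ℕ))) {z : ℕ × ℕ}
    (hz : IsAddableNode ν z) : rowLen ν z.1 = z.2 := by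
  have h : ν.filter (fun c => c.1 = z.1) = (Finset.range z.2).image (fun j => (z.1, j)) := by
    ext x
    constructor
    · intro hx
      obtain ⟨hmem, hx1⟩ := Finset.mem_filter.1 hx
      have hmem' : (z.1, x.2) ∈ ν := by rwa [show (z.1, x.2) = x from Prod.ext hx1.symm rfl]
      exact Finset.mem_image.2
        ⟨x.2, Finset.mem_range.2 ((mk_fst_mem_iff hν hz x.2).1 hmem'), Prod.ext hx1.symm rfl⟩
    · intro hx
      obtain ⟨k, hk, rfl⟩ := Finset.mem_image.1 hx
      exact Finset.mem_filter.2 ⟨(mk_fst_mem_iff hν hz k).2 (Finset.mem_range.1 hk), rfl⟩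
  rw [rowLen, h, Finset.card_image_of_injective _ fun a b hab => (Prod.ext_iff.1 hab).2,
    Finset.card_range]

set_option linter.dupNamespace false in
/-- For an addable node `z` of a lower set `ν`: `colLen ν z.2 = z.1`. [folklore] -/
private theorem colLen_snd {ν : Finset (ℕ × ℕ)} (hν : IsLowerSet (ν : Set (ℕ × ℕ))) {z : ℕ × ℕ}
    (hz : IsAddableNode ν z) : colLen ν z.2 = z.1 := by
  have h : ν.filter (fun c => c.2 = z.2) = (Finset.range z.1).image (fun i => (i, z.2)) := by
    ext x
    constructor
    · intro hx
      obtain ⟨hmem, hx2⟩ := Finset.mem_filter.1 hx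
      have hmem' : (x.1, z.2) ∈ ν := by rwa [show (x.1, z.2) = x from Prod.ext rfl hx2.symm]
      exact Finset.mem_image.2
        ⟨x.1, Finset.mem_range.2 ((mk_snd_mem_iff hν hz x.1).1 hmem'), Prod.ext rfl hx2.symm⟩
    · intro hx
      obtain ⟨k, hk, rfl⟩ := Finset.mem_image.1 hx
      exact Finset.mem_filter.2 ⟨(mk_snd_mem_iff hν hz k).2 (Finset.mem_range.1 hk), rfl⟩
  rw [colLen, h, Finset.card_image_of_injective _ fun a b hab => (Prod.ext_iff.1 hab).1,
    Finset.card_range]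

set_option linter.dupNamespace false in
/-- An addable node of a lower set `ν` has row index `≤ |ν|`. [folklore] -/
private theorem fst_le_card {ν : Finset (ℕ × ℕ)} (hν : IsLowerSet (ν : Set (ℕ × ℕ))) {z : ℕ × ℕ}
    (hz : IsAddableNode ν z) : z.1 ≤ ν.card := by
  rcases hz.2.1 with h0 | hmem
  · omega
  · have h : z.1 - 1 < ν.card := fst_lt_card hν hmem
    omega

set_option linter.dupNamespace false in
/-- An addable node of a lower set `ν` has column index `≤ |ν|`. [folklore] -/
private theorem snd_le_card {ν : Finset (ℕ × ℕ)} (hν : IsLowerSet (ν : Set (ℕ × ℕ))) {z : ℕ × ℕ}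
    (hz : IsAddableNode ν z) : z.2 ≤ ν.card := by
  rcases hz.2.2 with h0 | hmem
  · omega
  · have h : z.2 - 1 < ν.card := snd_lt_card hν hmem
    omega

/-! ### Effect of inserting a corner on lengths, charges and charge tails -/

set_option linter.dupNamespace false in
/-- Inserting a new cell `z ∉ ν` lengthens row `z.1` by one and no other row. [folklore] -/
private theorem rowLen_insert {ν : Finset (ℕ × ℕ)} {z : ℕ × ℕ} (hz : z ∉ ν) (i : ℕ) :
    rowLen (insert z ν) i = rowLen ν i + if i = z.1 then 1 else 0 := by
  unfold rowLen
  rw [Finset.filter_insert]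
  by_cases h : z.1 = i
  · rw [if_pos h, if_pos h.symm,
      Finset.card_insert_of_notMem fun h' => hz (Finset.mem_filter.1 h').1]
  · rw [if_neg h, if_neg (Ne.symm h), add_zero]

set_option linter.dupNamespace false in
/-- Inserting a new cell `z ∉ ν` lengthens column `z.2` by one and no other column. [folklore] -/
private theorem colLen_insert {ν : Finset (ℕ × ℕ)} {z : ℕ × ℕ} (hz : z ∉ ν) (j : ℕ) :
    colLen (insert z ν) j = colLen ν j + if j = z.2 then 1 else 0 := by
  unfold colLen
  rw [Finset.filter_insert]
  by_cases h : z.2 = j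
  · rw [if_pos h, if_pos h.symm,
      Finset.card_insert_of_notMem fun h' => hz (Finset.mem_filter.1 h').1]
  · rw [if_neg h, if_neg (Ne.symm h), add_zero]

set_option linter.dupNamespace false in
/-- Parity flip: lengthening a line of length `n` and sign `(−1)^k` by one cell changes its charge
by `(−1)^(k+n)`. [folklore] -/
private theorem ite_odd_succ (n k : ℕ) :
    (if Odd (n + 1) then (-1 : ℤ) ^ k else 0)
      = (if Odd n then (-1 : ℤ) ^ k else 0) + (-1) ^ (k + n) := by
  rcases Nat.even_or_odd n with h | h
  · rw [if_pos (Nat.odd_add_one.2 (Nat.not_odd_iff_even.2 h)), if_neg (Nat.not_odd_iff_even.2 h),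
      pow_add, h.neg_one_pow]
    ring
  · rw [if_neg fun h' => Nat.odd_add_one.1 h' h, if_pos h, pow_add, h.neg_one_pow]
    ring

set_option linter.dupNamespace false in
/-- Inserting the addable node `z = (r, c)` into the lower set `ν` changes the row charges only at
row `r`, by `π = (−1)^(r+c)` (row `r` has length `c` before and `c + 1` after). [folklore] -/
private theorem rowCharge_insert {ν : Finset (ℕ × ℕ)} (hν : IsLowerSet (ν : Set (ℕ × ℕ)))
    {z : ℕ × ℕ} (hz : IsAddableNode ν z) (i : ℕ) :
    rowCharge (insert z ν) i = rowCharge ν i + if i = z.1 then (-1) ^ (z.1 + z.2) else 0 := by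
  unfold rowCharge
  rw [rowLen_insert hz.1]
  by_cases hi : i = z.1
  · rw [if_pos hi, if_pos hi, hi, rowLen_fst hν hz]
    exact ite_odd_succ z.2 z.1
  · rw [if_neg hi, if_neg hi, add_zero, add_zero]

set_option linter.dupNamespace false in
/-- Inserting the addable node `z = (r, c)` into the lower set `ν` changes the column charges only
at column `c`, by `π = (−1)^(r+c)`. [folklore] -/
private theorem colCharge_insert {ν : Finset (ℕ × ℕ)} (hν : IsLowerSet (ν : Set (ℕ × ℕ)))
    {z : ℕ × ℕ} (hz : IsAddableNode ν z) (j : ℕ) :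
    colCharge (insert z ν) j = colCharge ν j + if j = z.2 then (-1) ^ (z.1 + z.2) else 0 := by
  unfold colCharge
  rw [colLen_insert hz.1]
  by_cases hj : j = z.2
  · rw [if_pos hj, if_pos hj, hj, colLen_snd hν hz, add_comm z.1 z.2]
    exact ite_odd_succ z.1 z.2
  · rw [if_neg hj, if_neg hj, add_zero, add_zero]

set_option linter.dupNamespace false in
/-- Peeling a vanishing top index off a filtered range sum. [folklore] -/
private theorem sum_filter_range_succ_of_eq_zero {f : ℕ → ℤ} {n : ℕ} (hf : f n = 0) (r : ℕ) :
    ∑ i ∈ (Finset.range (n + 1)).filter (fun i => r < i), f i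
      = ∑ i ∈ (Finset.range n).filter (fun i => r < i), f i := by
  rw [Finset.sum_filter, Finset.sum_range_succ, hf, ite_self, add_zero, Finset.sum_filter]

set_option linter.dupNamespace false in
/-- Inserting the addable node `z = (r, c)` into the lower set `ν` changes the charge strictly
below row `r'` by `[r' < r] · π`. [folklore] -/
private theorem chargeBelow_insert {ν : Finset (ℕ × ℕ)} (hν : IsLowerSet (ν : Set (ℕ × ℕ)))
    {z : ℕ × ℕ} (hz : IsAddableNode ν z) (r : ℕ) :
    chargeBelow (insert z ν) r = chargeBelow ν r + if r < z.1 then (-1) ^ (z.1 + z.2) else 0 := by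
  have hzr : z.1 ≤ ν.card := fst_le_card hν hz
  have htop : rowCharge (insert z ν) (ν.card + 1) = 0 := by
    have h0 : rowLen (insert z ν) (ν.card + 1) = 0 := by
      rw [rowLen_insert hz.1, if_neg (by omega), add_zero]
      exact rowLen_eq_zero hν (Nat.le_succ _)
    rw [rowCharge, h0, if_neg Nat.not_odd_zero]
  unfold chargeBelow
  rw [Finset.card_insert_of_notMem hz.1, sum_filter_range_succ_of_eq_zero htop,
    Finset.sum_congr rfl fun i _ => rowCharge_insert hν hz i, Finset.sum_add_distrib,
    Finset.sum_ite_eq']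
  by_cases h : r < z.1
  · rw [if_pos (Finset.mem_filter.2 ⟨Finset.mem_range.2 (Nat.lt_succ_of_le hzr), h⟩), if_pos h]
  · rw [if_neg fun h' => h (Finset.mem_filter.1 h').2, if_neg h]

set_option linter.dupNamespace false in
/-- Inserting the addable node `z = (r, c)` into the lower set `ν` changes the charge strictly
right of column `c'` by `[c' < c] · π`. [folklore] -/
private theorem chargeRight_insert {ν : Finset (ℕ × ℕ)} (hν : IsLowerSet (ν : Set (ℕ × ℕ)))
    {z : ℕ × ℕ} (hz : IsAddableNode ν z) (c : ℕ) :
    chargeRight (insert z ν) c = chargeRight ν c + if c < z.2 then (-1) ^ (z.1 + z.2) else 0 := by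
  have hzc : z.2 ≤ ν.card := snd_le_card hν hz
  have htop : colCharge (insert z ν) (ν.card + 1) = 0 := by
    have h0 : colLen (insert z ν) (ν.card + 1) = 0 := by
      rw [colLen_insert hz.1, if_neg (by omega), add_zero]
      exact colLen_eq_zero hν (Nat.le_succ _)
    rw [colCharge, h0, if_neg Nat.not_odd_zero]
  unfold chargeRight
  rw [Finset.card_insert_of_notMem hz.1, sum_filter_range_succ_of_eq_zero htop,
    Finset.sum_congr rfl fun j _ => colCharge_insert hν hz j, Finset.sum_add_distrib,
    Finset.sum_ite_eq']
  by_cases h : c < z.2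
  · rw [if_pos (Finset.mem_filter.2 ⟨Finset.mem_range.2 (Nat.lt_succ_of_le hzc), h⟩), if_pos h]
  · rw [if_neg fun h' => h (Finset.mem_filter.1 h').2, if_neg h]

/-! ### Relative position of two corners, and the statement -/

set_option linter.dupNamespace false in
/-- Two distinct addable nodes of a lower set lie strictly north-east / south-west of each other.
[folklore] -/
private theorem addable_ne_dichotomy {ν : Finset (ℕ × ℕ)} (hν : IsLowerSet (ν : Set (ℕ × ℕ)))
    {y z : ℕ × ℕ} (hy : IsAddableNode ν y) (hz : IsAddableNode ν z) (hne : y ≠ z) :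
    (y.1 < z.1 ∧ z.2 < y.2) ∨ (z.1 < y.1 ∧ y.2 < z.2) := by
  rcases lt_trichotomy y.1 z.1 with h | h | h
  · refine Or.inl ⟨h, ?_⟩
    have hmem : (z.1 - 1, z.2) ∈ ν := hz.2.1.resolve_left (by omega)
    exact (mk_fst_mem_iff hν hy z.2).1 (mem_of_le hν hmem (Nat.le_sub_one_of_lt h) le_rfl)
  · exfalso
    rcases lt_trichotomy y.2 z.2 with h' | h' | h'
    · have hmem := (mk_fst_mem_iff hν hz y.2).2 h'
      rw [← h] at hmem
      exact hy.1 hmem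
    · exact hne (Prod.ext h h')
    · have hmem := (mk_fst_mem_iff hν hy z.2).2 h'
      rw [h] at hmem
      exact hz.1 hmem
  · refine Or.inr ⟨h, ?_⟩
    have hmem : (y.1 - 1, y.2) ∈ ν := hy.2.1.resolve_left (by omega)
    exact (mk_fst_mem_iff hν hz y.2).1 (mem_of_le hν hmem (Nat.le_sub_one_of_lt h) le_rfl)

set_option linter.dupNamespace false in
/-- **(F2a) Increments of the other corners shift by `±π_z`.**  For a finite lower set `ν` (a Young
diagram) and two distinct addable nodes `y ≠ z = (r, c)`, inserting `z` changes the J-increment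
seen from `y` by `+(−1)^{r+c}` if `y` lies strictly above `z` (then it is strictly to its right, and
only the row tail changes) and by `−(−1)^{r+c}` otherwise (then `y` is strictly below-left of `z`,
and only the column tail changes). [folklore] -/
theorem incr_insert_of_ne : ∀ (ν : Finset (ℕ × ℕ)), IsLowerSet (ν : Set (ℕ × ℕ)) →
    ∀ (y z : ℕ × ℕ), y ∈ addableNodes ν → z ∈ addableNodes ν → y ≠ z →
      incr (insert z ν) y = incr ν y + (if y.1 < z.1 then (-1 : ℤ) ^ (z.1 + z.2) else -(-1 : ℤ) ^ (z.1 + z.2)) := by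
  intro ν hν y z hy hz hne
  rw [Literature.RepresentationTheory.FiniteGroups.mem_addableNodes] at hy hz
  rw [incr, incr, chargeBelow_insert hν hz, chargeRight_insert hν hz]
  rcases addable_ne_dichotomy hν hy hz hne with ⟨h1, h2⟩ | ⟨h1, h2⟩
  · rw [if_pos h1, if_neg (Nat.not_lt.2 h2.le), if_pos h1]
    ring
  · rw [if_neg (Nat.not_lt.2 h1.le), if_pos h2, if_neg (Nat.not_lt.2 h1.le)]
    ring

end Summit.MatrixMultiplication.MatrixMultiplication.Theorems
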